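import Literature.Analysis.Approximation.TuranNazarovRemez
import Literature.Analysis.Approximation.TuranNazarovWeakCauchy
import Literature.Analysis.Approximation.TuranNazarov
import Mathlib.Analysis.Calculus.LogDeriv
import Mathlib.MeasureTheory.Measure.Lebesgue.Basic
import HarnessLib

/-!
# Turán–Nazarov inequality, proofs — Part 5: pruning, the geometric-mean induction, and the discharge of `TuranNazarov.lemma`

Fifth and last file of the formalization of O. Friedland, *A disk-growth Remez principle and a
modular proof of the measurable Turán–Nazarov inequality*, arXiv:2606.24823 (2026)
[Friedland2026DiskGrowthRemez], discharging the named fact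
`Literature.Analysis.Approximation.TuranNazarov.lemma` (Nazarov 1993; Friedland–Yomdin 2011,
Thm 1.1) as `TuranNazarov.lemma_holds`, with the absolute constant `c = e^{16000}` (explicit, not
optimized).  Road map in `Literature/Analysis/Approximation/TuranNazarovProofs.lean`; inputs:
Part 1 (interval Turán, disk growth), Part 2 (`weak_cauchy`, Lemma B.2), Part 3 (zero-free
quotients, extraction of zeros), Part 4 (`disk_growth_remez`, `expsum_geometric_remez`,
`geometric_mean_bound`).  Theorems only.

## Contents

* `zero_free_factorization`, `weak_log_deriv` — **Lemma 4.1** (weak logarithmic derivative) for an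
  entire function with all-scales disk growth `(a,b,d)`:
  `|{t ∈ I₀ : f ≠ 0, |f'/f| > u}| ≤ 25000(a+b+d)/u` (zeros in `D̄(0,2)` factored out as in
  Prop 2.1, `log_deriv_bound` = Lemma A.3 for the zero-free factor, `weak_cauchy` = Lemma B.2 for
  `∑ 1/(t - w_i)`).
* `hasDerivAt_expsum`, `deriv_expsum`, `prune_identity` — `(D - a)p = ∑_{λ≠a} (λ-a)c_λ e^{λt}`;
  `expsum_exists_ne_zero`, `expsum_ne_zero` — a reduced exponential sum is not identically zero;
  `real_zeros_finite`, `ae_restrict_ne_zero`, `exists_mem_ne_zero` — its real zeros in `I₀` are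
  finitely many (the paper's "harmless finite set"; here `Real.log 0 = 0`).
* `log_expsum_integrableOn` — `log|p| ∈ L¹(E)` for every exponential sum and `E ⊆ I₀`.
* `pruning_weak` — **Lemma 4.2**: spectrum in `D̄(a,ρ)`, `ρ ≥ n = #Λ ≥ 2` ⟹
  `|{t ∈ I₀ : p ≠ 0, |Q_a| > u|p|}| ≤ 135000/u` for `Q_a = ρ⁻¹(D-a)p`.
* `geometric_quotient_control`, `pruning_step` — **Lemma 4.3**: `G_E(Q_a) ≤ (270000 e/α) G_E(p)`,
  i.e. `∫_E log|Q_a| ≤ ∫_E log|p| + α(log(270000/α) + 1)`, via `geometric_mean_bound` (`d = 1`)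
  applied to `1/max(1,|Q_a|/|p|)`.
* `single_exponential_factor` — **Lemma 3.3**.
* `geometric_turan_nazarov` — **Theorem 5.1** (normalized geometric form on `I₀`, induction on the
  number of terms in geometric-mean form on the ORIGINAL set `E`):
  `sup_{I₀}|p| ≤ e^{max|Re λ|} (e^{16000}/α)^{n} G_E(p)` for `n+1` reduced terms.
* `expsum_reduce`, `geom_mean_le_bound`, `lemma_holds` — reduction of the representation, the step
  `G_E(p) ≤ sup_Ω|p|` (**Cor 1.3**), the affine scaling `[a,b] → I₀` (**Thm 1.2**), and the
  discharge `theorem lemma_holds : TuranNazarov.lemma`.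
-/

noncomputable section

open Complex Metric Set Real Filter Topology MeasureTheory

namespace Literature.Analysis.Approximation

namespace TuranNazarov

/-! ### Part 5a: the weak logarithmic-derivative estimate (Friedland 2026, Lemma 4.1) -/

/-- **Zero-free factorization with oscillation control** (steps (1)–(5) of the proof of Prop 2.1,
repackaged for Lemma 4.1): an entire `f ≠ 0` with all-scales disk growth `(a,b,d)` and
`|f(x₀)| ≥ 1` somewhere on `I₀` factors on `D(0,5)` as `∏_{i<N}(z - w_i) · h(z)` with
`N ≤ 35(a+b+d)` zeros `|w_i| ≤ 2`, `h` analytic on `D(0,5)`, zero-free on `D̄(0,2)`, and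
`|log|h(z)| - log|h(0)|| ≤ 21(4a+b+3d+2N)` on `D̄(0,3/2)` (Harnack, `zero_free_lower`).
[cite: Friedland2026DiskGrowthRemez, Appendix B, proof of Lemma 4.1] -/
theorem zero_free_factorization {f : ℂ → ℂ} (hf : ∀ z, AnalyticAt ℂ f z) (hf0 : f ≠ 0)
    {a b : ℝ} {d : ℕ} (hb : 0 ≤ b) (hd : 1 ≤ d)
    (hDG : ∀ (z₀ : ℂ) (r R S : ℝ), 0 < r → r ≤ R →
      (∀ ζ ∈ closedBall z₀ r, ‖f ζ‖ ≤ S) → ∀ z ∈ closedBall z₀ R,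
        ‖f z‖ ≤ Real.exp (a * R + b) * (R / r) ^ d * S)
    (hone : ∃ x₀ : ℝ, x₀ ∈ Icc (-1/2 : ℝ) (1/2) ∧ 1 ≤ ‖f x₀‖) :
    ∃ (N : ℕ) (w : Fin N → ℂ) (h : ℂ → ℂ), (N : ℝ) ≤ 35 * (a + b + d) ∧
      (∀ i, ‖w i‖ ≤ 2) ∧ AnalyticOnNhd ℂ h (ball 0 5) ∧ (∀ z ∈ closedBall (0 : ℂ) 2, h z ≠ 0) ∧
      (∀ z ∈ ball (0 : ℂ) 5, f z = (∏ i, (z - w i)) * h z) ∧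
      ∀ z ∈ closedBall (0 : ℂ) (3 / 2),
        |Real.log ‖h z‖ - Real.log ‖h 0‖| ≤ 21 * (4 * a + b + 3 * d + 2 * N) := by
  classical
  have hd0 : (1 : ℝ) ≤ d := by exact_mod_cast hd
  -- (1) zeros in `D̄(0,2)` and the factorization on `D(0,5)`
  obtain ⟨Z, n, h, hZ, hndiv, -, hh_an, hh_ne, hfac⟩ :=
    extract_zeros hf hf0 0 (ρ := 2) (R₀ := 5) (by norm_num)
  obtain ⟨N, w, hN, hwZ, hprod⟩ := zeros_enum Z n
  have hw2 : ∀ i, ‖w i‖ ≤ 2 := fun i => by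
    have := ((hZ (w i)).1 (hwZ i)).2
    rwa [mem_closedBall, dist_zero_right] at this
  have hfac' : ∀ z ∈ ball (0 : ℂ) 5, f z = (∏ i, (z - w i)) * h z := fun z hz => by
    rw [hfac z hz, hprod]
  -- (2) the maximum `M₁` of `|f|` on `D̄(0,1)`
  obtain ⟨x₀, hx₀, hfx₀⟩ := hone
  have hcont : Continuous fun z => ‖f z‖ :=
    continuous_norm.comp (continuous_iff_continuousAt.2 fun z => (hf z).continuousAt)
  obtain ⟨w₁, hw₁, hw₁max⟩ := (isCompact_closedBall (0 : ℂ) 1).exists_isMaxOn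
    ⟨0, mem_closedBall_self zero_le_one⟩ hcont.continuousOn
  set M₁ : ℝ := ‖f w₁‖ with hM₁
  have hw₁max' : ∀ z ∈ closedBall (0 : ℂ) 1, ‖f z‖ ≤ M₁ := fun z hz => hw₁max hz
  have hw₁n : ‖w₁‖ ≤ 1 := by simpa using hw₁
  have hx₀b : (x₀ : ℂ) ∈ closedBall (0 : ℂ) 1 := by
    rw [mem_closedBall, dist_zero_right, Complex.norm_real, Real.norm_eq_abs, abs_le]
    constructor <;> linarith [hx₀.1, hx₀.2]
  have hM₁1 : 1 ≤ M₁ := hfx₀.trans (hw₁max' _ hx₀b)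
  have hM₁0 : 0 < M₁ := by linarith
  have hfw₁ : f w₁ ≠ 0 := by
    intro h0; rw [hM₁, h0, norm_zero] at hM₁1; linarith
  -- (3) disk growth from `D̄(0,1)` to `D̄(0,4)` and `D̄(0,5)`
  set M₄ : ℝ := Real.exp (a * 4 + b) * (4 / 1) ^ d * M₁ with hM₄
  set M₅ : ℝ := Real.exp (a * 5 + b) * (5 / 1) ^ d * M₁ with hM₅
  have hM₄b : ∀ z ∈ closedBall (0 : ℂ) 4, ‖f z‖ ≤ M₄ :=
    hDG 0 1 4 M₁ one_pos (by norm_num) hw₁max'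
  have hM₅b : ∀ z ∈ closedBall (0 : ℂ) 5, ‖f z‖ ≤ M₅ :=
    hDG 0 1 5 M₁ one_pos (by norm_num) hw₁max'
  have hM₁M₄ : M₁ ≤ M₄ := hM₄b w₁ (closedBall_subset_closedBall (by norm_num) hw₁)
  have hM₄1 : 1 ≤ M₄ := hM₁1.trans hM₁M₄
  have hM₄0 : 0 < M₄ := by linarith
  have hM₁M₅ : M₁ ≤ M₅ := hM₅b w₁ (closedBall_subset_closedBall (by norm_num) hw₁)
  -- (4) zero count
  have hNle : (N : ℝ) ≤ 35 * (a + b + d) := by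
    have hZ' : ∀ u ∈ Z, u ∈ closedBall w₁ 3 := by
      intro u hu
      have hu2 : ‖u‖ ≤ 2 := by simpa using ((hZ u).1 hu).2
      rw [mem_closedBall, dist_eq_norm]
      calc ‖u - w₁‖ ≤ ‖u‖ + ‖w₁‖ := norm_sub_le _ _
        _ ≤ 3 := by linarith
    have hsph : ∀ z ∈ sphere w₁ (7 / 2), ‖f z‖ ≤ M₅ := by
      intro z hz
      apply hM₅b
      rw [mem_sphere, dist_eq_norm] at hz
      rw [mem_closedBall, dist_zero_right]
      calc ‖z‖ = ‖(z - w₁) + w₁‖ := by rw [sub_add_cancel]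
        _ ≤ ‖z - w₁‖ + ‖w₁‖ := norm_add_le _ _
        _ ≤ 5 := by linarith
    have J := count_le_jensen hf Z n hZ' hndiv (by norm_num) (by norm_num : (3 : ℝ) < 7 / 2)
      (hM₁1.trans hM₁M₅) hfw₁ hsph
    rw [← hN] at J
    have hlog1 : Real.log (M₅ / ‖f w₁‖) ≤ 5 * a + b + 4 * d := by
      have : M₅ / ‖f w₁‖ = Real.exp (a * 5 + b) * 5 ^ d := by
        rw [← hM₁, hM₅]; field_simp
      rw [this, Real.log_mul (Real.exp_pos _).ne' (by positivity), Real.log_exp, Real.log_pow]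
      have : Real.log 5 ≤ 4 := by
        have := Real.log_le_sub_one_of_pos (by norm_num : (0:ℝ) < 5); linarith
      nlinarith
    have hlog2 : 1 / 7 ≤ Real.log (7 / 2 / 3) := by
      have := Real.one_sub_inv_le_log_of_pos (by norm_num : (0:ℝ) < 7 / 2 / 3)
      norm_num at this ⊢
      linarith
    have hlog2' : 0 < Real.log (7 / 2 / 3) := by linarith
    rw [le_div_iff₀ hlog2'] at J
    nlinarith
  -- (5) bounds for the zero-free factor `h`
  have hP4 : ∀ z ∈ sphere (0 : ℂ) 4, 1 ≤ ‖∏ i, (z - w i)‖ := by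
    intro z hz
    rw [mem_sphere, dist_zero_right] at hz
    rw [norm_prod]
    calc (1 : ℝ) = ∏ _i : Fin N, (1 : ℝ) := by simp
      _ ≤ ∏ i, ‖z - w i‖ := by
          apply Finset.prod_le_prod (fun _ _ => zero_le_one) fun i _ => ?_
          have := norm_sub_norm_le z (w i)
          linarith [hw2 i]
  have hh4 : ∀ z ∈ closedBall (0 : ℂ) 4, ‖h z‖ ≤ M₄ := by
    have hdc : DiffContOnCl ℂ h (ball (0 : ℂ) 4) := by
      apply DifferentiableOn.diffContOnCl
      rw [closure_ball 0 (by norm_num)]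
      exact (hh_an.mono (closedBall_subset_ball (by norm_num))).differentiableOn
    intro z hz
    apply Complex.norm_le_of_forall_mem_frontier_norm_le isBounded_ball hdc _
      (by rw [closure_ball 0 (by norm_num)]; exact hz)
    intro v hv
    rw [frontier_ball 0 (by norm_num)] at hv
    have hv5 : v ∈ ball (0 : ℂ) 5 := by
      rw [mem_sphere, dist_zero_right] at hv; rw [mem_ball, dist_zero_right]; linarith
    have h1 := hM₄b v (sphere_subset_closedBall hv)
    rw [hfac' v hv5, norm_mul] at h1
    have h2 := hP4 v hv
    calc ‖h v‖ = 1 * ‖h v‖ := (one_mul _).symm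
      _ ≤ ‖∏ i, (v - w i)‖ * ‖h v‖ := by gcongr
      _ ≤ M₄ := h1
  have hPw₁ : ‖∏ i, (w₁ - w i)‖ ≤ 3 ^ N := by
    rw [norm_prod]
    calc ∏ i, ‖w₁ - w i‖ ≤ ∏ _i : Fin N, (3 : ℝ) := by
          apply Finset.prod_le_prod (fun i _ => norm_nonneg _) fun i _ => ?_
          calc ‖w₁ - w i‖ ≤ ‖w₁‖ + ‖w i‖ := norm_sub_le _ _
            _ ≤ 3 := by linarith [hw2 i]
      _ = 3 ^ N := by simp
  have hw₁5 : w₁ ∈ ball (0 : ℂ) 5 := by rw [mem_ball, dist_zero_right]; linarith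
  have hhw₁ : M₁ ≤ 3 ^ N * ‖h w₁‖ := by
    have h1 : M₁ = ‖∏ i, (w₁ - w i)‖ * ‖h w₁‖ := by rw [hM₁, hfac' w₁ hw₁5, norm_mul]
    rw [h1]; gcongr
  have hhw₁0 : 0 < ‖h w₁‖ := by
    have : (0 : ℝ) < 3 ^ N := by positivity
    nlinarith
  have hlogM₄ : Real.log M₄ - Real.log M₁ ≤ 4 * a + b + 3 * d := by
    rw [← Real.log_div hM₄0.ne' hM₁0.ne']
    have : M₄ / M₁ = Real.exp (a * 4 + b) * 4 ^ d := by rw [hM₄]; field_simp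
    rw [this, Real.log_mul (Real.exp_pos _).ne' (by positivity), Real.log_exp, Real.log_pow]
    have : Real.log 4 ≤ 3 := by
      have := Real.log_le_sub_one_of_pos (by norm_num : (0:ℝ) < 4); linarith
    nlinarith
  have hloghw₁ : Real.log M₁ - N * 2 ≤ Real.log ‖h w₁‖ := by
    have h1 := Real.log_le_log hM₁0 hhw₁
    rw [Real.log_mul (by positivity) hhw₁0.ne', Real.log_pow] at h1
    have : Real.log 3 ≤ 2 := by
      have := Real.log_le_sub_one_of_pos (by norm_num : (0:ℝ) < 3); linarith
    nlinarith [Nat.cast_nonneg (α := ℝ) N]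
  -- the two-sided oscillation bound on `D̄(0,3/2)`
  have hosc : ∀ v ∈ closedBall (0 : ℂ) (3 / 2),
      Real.log M₄ - 21 * (4 * a + b + 3 * d + 2 * N) ≤ Real.log ‖h v‖ ∧ Real.log ‖h v‖ ≤ Real.log M₄ := by
    intro v hv
    have key := zero_free_lower (hh_an.mono (closedBall_subset_ball (by norm_num)))
      hh_ne (fun z hz => hh4 z (closedBall_subset_closedBall (by norm_num) hz)) hw₁ hv
      (M := M₄)
    have hv0 : h v ≠ 0 := hh_ne v (closedBall_subset_closedBall (by norm_num) hv)
    refine ⟨by nlinarith [Nat.cast_nonneg (α := ℝ) N], ?_⟩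
    exact Real.log_le_log (norm_pos_iff.2 hv0) (hh4 v (closedBall_subset_closedBall (by norm_num) hv))
  refine ⟨N, w, h, hNle, hw2, hh_an, hh_ne, hfac', fun z hz => ?_⟩
  have h0 := hosc 0 (mem_closedBall_self (by norm_num))
  have hz' := hosc z hz
  rw [abs_le]
  constructor <;> linarith [h0.1, h0.2, hz'.1, hz'.2]

/-- **Weak logarithmic-derivative estimate** (Friedland 2026, Lemma 4.1, for an entire function
with all-scales disk growth `(a,b,d)` that does not vanish identically on `I₀`): for `u > 0`,
`|{t ∈ I₀ : f(t) ≠ 0, |f'(t)/f(t)| > u}| ≤ 25000 (a+b+d)/u`.  Proof as printed: factor out the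
zeros in `D̄(0,2)`, bound the logarithmic derivative of the zero-free factor by `log_deriv_bound`
(Lemma A.3), and apply the weak Cauchy estimate `weak_cauchy` (Lemma B.2) to `∑ 1/(t - w_i)`.
[cite: Friedland2026DiskGrowthRemez, Lemma 4.1] -/
theorem weak_log_deriv {f : ℂ → ℂ} (hf : ∀ z, AnalyticAt ℂ f z)
    {a b : ℝ} {d : ℕ} (ha : 0 ≤ a) (hb : 0 ≤ b) (hd : 1 ≤ d)
    (hDG : ∀ (z₀ : ℂ) (r R S : ℝ), 0 < r → r ≤ R →
      (∀ ζ ∈ closedBall z₀ r, ‖f ζ‖ ≤ S) → ∀ z ∈ closedBall z₀ R,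
        ‖f z‖ ≤ Real.exp (a * R + b) * (R / r) ^ d * S)
    (hnz : ∃ x₁ : ℝ, x₁ ∈ Icc (-1 / 2 : ℝ) (1 / 2) ∧ f x₁ ≠ 0) {u : ℝ} (hu : 0 < u) :
    volume {t : ℝ | t ∈ Icc (-1 / 2 : ℝ) (1 / 2) ∧ f t ≠ 0 ∧ u < ‖deriv f t / f t‖} ≤
      ENNReal.ofReal (25000 * (a + b + d) / u) := by
  classical
  have hd0 : (1 : ℝ) ≤ d := by exact_mod_cast hd
  obtain ⟨x₁, hx₁, hfx₁⟩ := hnz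
  -- normalization `g = f / sup_{I₀} |f|`
  have hfcont : Continuous f := continuous_iff_continuousAt.2 fun z => (hf z).continuousAt
  have hcontR : Continuous fun t : ℝ => ‖f t‖ :=
    continuous_norm.comp (hfcont.comp Complex.continuous_ofReal)
  obtain ⟨x₀, hx₀, hmax⟩ := isCompact_Icc.exists_isMaxOn ⟨x₁, hx₁⟩ hcontR.continuousOn
  set M : ℝ := ‖f x₀‖ with hM
  have hmax' : ∀ t ∈ Icc (-1 / 2 : ℝ) (1 / 2), ‖f t‖ ≤ M := fun t ht => hmax ht
  have hM0 : 0 < M := lt_of_lt_of_le (norm_pos_iff.2 hfx₁) (hmax' x₁ hx₁)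
  set g : ℂ → ℂ := fun z => (M : ℂ)⁻¹ * f z with hg
  have hng : ∀ z, ‖g z‖ = M⁻¹ * ‖f z‖ := fun z => by
    simp only [hg, norm_mul, norm_inv, Complex.norm_real, Real.norm_eq_abs, abs_of_pos hM0]
  have hga : ∀ z, AnalyticAt ℂ g z := fun z => analyticAt_const.mul (hf z)
  have hgx₀ : ‖g x₀‖ = 1 := by rw [hng, ← hM, inv_mul_cancel₀ hM0.ne']
  have hg0 : g ≠ 0 := by
    intro h
    have h1 := hgx₀
    rw [h] at h1
    simp at h1
  have hDGg : ∀ (z₀ : ℂ) (r R S : ℝ), 0 < r → r ≤ R →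
      (∀ ζ ∈ closedBall z₀ r, ‖g ζ‖ ≤ S) → ∀ z ∈ closedBall z₀ R,
        ‖g z‖ ≤ Real.exp (a * R + b) * (R / r) ^ d * S := by
    intro z₀ r R S hr hrR hS z hz
    have hS' : ∀ ζ ∈ closedBall z₀ r, ‖f ζ‖ ≤ M * S := fun ζ hζ => by
      have := hS ζ hζ
      rwa [hng, inv_mul_le_iff₀ hM0] at this
    have := hDG z₀ r R (M * S) hr hrR hS' z hz
    rw [hng, inv_mul_le_iff₀ hM0]
    calc ‖f z‖ ≤ Real.exp (a * R + b) * (R / r) ^ d * (M * S) := this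
      _ = M * (Real.exp (a * R + b) * (R / r) ^ d * S) := by ring
  have hone : ∃ x : ℝ, x ∈ Icc (-1 / 2 : ℝ) (1 / 2) ∧ 1 ≤ ‖g x‖ := ⟨x₀, hx₀, hgx₀.ge⟩
  obtain ⟨N, w, h, hN, hw2, hh_an, hh_ne, hfac, hosc⟩ :=
    zero_free_factorization hga hg0 hb hd hDGg hone
  set K₁ : ℝ := 21 * (4 * a + b + 3 * d + 2 * N) with hK₁
  have hN0 : (0 : ℝ) ≤ N := Nat.cast_nonneg N
  -- the logarithmic derivative of the zero-free factor
  have hld : ∀ x ∈ closedBall (0 : ℂ) (1 / 2), ‖deriv h x / h x‖ ≤ 8 * K₁ + 8 := fun x hx =>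
    log_deriv_bound (hh_an.mono (ball_subset_ball (by norm_num))).differentiableOn
      (fun z hz => hh_ne z (ball_subset_closedBall hz)) hosc hx
  -- the logarithmic derivative of `f` at a real non-zero
  have hkey : ∀ t : ℝ, t ∈ Icc (-1 / 2 : ℝ) (1 / 2) → f t ≠ 0 →
      deriv f t / f t = ∑ i, ((t : ℂ) - w i)⁻¹ + deriv h t / h t := by
    intro t ht hft
    have htn : ‖(t : ℂ)‖ ≤ 1 / 2 := by
      rw [Complex.norm_real, Real.norm_eq_abs, abs_le]; constructor <;> linarith [ht.1, ht.2]
    have ht5 : (t : ℂ) ∈ ball (0 : ℂ) 5 := by rw [mem_ball, dist_zero_right]; linarith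
    have ht2 : (t : ℂ) ∈ closedBall (0 : ℂ) 2 := by rw [mem_closedBall, dist_zero_right]; linarith
    have hgt : g t ≠ 0 := mul_ne_zero (inv_ne_zero (Complex.ofReal_ne_zero.2 hM0.ne')) hft
    have hPh : (∏ i, ((t : ℂ) - w i)) * h t ≠ 0 := by rw [← hfac _ ht5]; exact hgt
    have hPt : (∏ i, ((t : ℂ) - w i)) ≠ 0 := left_ne_zero_of_mul hPh
    have hht : h t ≠ 0 := right_ne_zero_of_mul hPh
    have hfactor : ∀ i, (t : ℂ) - w i ≠ 0 := fun i =>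
      Finset.prod_ne_zero_iff.1 hPt i (Finset.mem_univ i)
    have h1 : deriv f t / f t = deriv g t / g t := by
      simp only [hg]
      rw [deriv_const_mul_field,
        mul_div_mul_left _ _ (inv_ne_zero (Complex.ofReal_ne_zero.2 hM0.ne'))]
    have h2 : deriv g t = deriv (fun z => (∏ i, (z - w i)) * h z) t :=
      Filter.EventuallyEq.deriv_eq
        (Filter.eventuallyEq_of_mem (isOpen_ball.mem_nhds ht5) fun z hz => hfac z hz)
    have h3 : logDeriv (fun z => (∏ i, (z - w i)) * h z) t =
        logDeriv (fun z => ∏ i, (z - w i)) t + logDeriv h t :=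
      logDeriv_mul (f := fun z => ∏ i, (z - w i)) (g := h) (t : ℂ) hPt hht (by fun_prop)
        (hh_an t ht5).differentiableAt
    have h4 : logDeriv (fun z : ℂ => ∏ i, (z - w i)) t = ∑ i, ((t : ℂ) - w i)⁻¹ := by
      rw [logDeriv_prod (f := fun i z => z - w i) (fun i _ => hfactor i) (fun i _ => by fun_prop)]
      refine Finset.sum_congr rfl fun i _ => ?_
      rw [logDeriv_apply, deriv_sub_const, deriv_id'', one_div]
    have h5 : logDeriv g t = logDeriv (fun z => (∏ i, (z - w i)) * h z) t := by
      rw [logDeriv_apply, logDeriv_apply, h2, hfac _ ht5]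
    rw [h1, ← logDeriv_apply, h5, h3, h4, logDeriv_apply]
  -- the estimate
  set S := {t : ℝ | t ∈ Icc (-1 / 2 : ℝ) (1 / 2) ∧ f t ≠ 0 ∧ u < ‖deriv f t / f t‖} with hS
  have hK₁le : 8 * K₁ + 8 ≤ 12440 * (a + b + d) := by
    rw [hK₁]; linarith
  by_cases hcase : u ≤ 2 * (8 * K₁ + 8)
  · calc volume S ≤ volume (Icc (-1 / 2 : ℝ) (1 / 2)) := measure_mono fun t ht => ht.1
      _ = 1 := by rw [Real.volume_Icc]; norm_num
      _ ≤ ENNReal.ofReal (25000 * (a + b + d) / u) := by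
          rw [← ENNReal.ofReal_one]
          apply ENNReal.ofReal_le_ofReal
          rw [le_div_iff₀ hu]
          linarith
  · push Not at hcase
    have hsub : S ⊆ {x : ℝ | u / 2 < ‖∑ j, ((x : ℂ) - w j)⁻¹‖} := by
      rintro t ⟨ht, hft, hut⟩
      have htb : (t : ℂ) ∈ closedBall (0 : ℂ) (1 / 2) := by
        rw [mem_closedBall, dist_zero_right, Complex.norm_real, Real.norm_eq_abs, abs_le]
        constructor <;> linarith [ht.1, ht.2]
      have h1 := hld t htb
      rw [hkey t ht hft] at hut
      have h2 := norm_add_le (∑ i, ((t : ℂ) - w i)⁻¹) (deriv h t / h t)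
      show u / 2 < _
      linarith
    have hN35 : (8 + 2 * Real.pi) * N ≤ 560 * (a + b + d) := by
      nlinarith [mul_nonneg (sub_nonneg.2 Real.pi_le_four) hN0, hN]
    have hHu : 0 ≤ (a + b + d) * u := by positivity
    calc volume S ≤ volume {x : ℝ | u / 2 < ‖∑ j, ((x : ℂ) - w j)⁻¹‖} := measure_mono hsub
      _ ≤ ENNReal.ofReal ((8 + 2 * Real.pi) * Fintype.card (Fin N) / (u / 2)) :=
          weak_cauchy w (by linarith)
      _ ≤ ENNReal.ofReal (25000 * (a + b + d) / u) := by
          apply ENNReal.ofReal_le_ofReal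
          rw [Fintype.card_fin, div_le_div_iff₀ (by linarith) hu]
          nlinarith [mul_le_mul_of_nonneg_right hN35 hu.le, hHu]


/-! ### Part 5b: exponential sums — derivative, pruning identity, non-vanishing, real zeros -/

/-- The complex derivative of an exponential sum `∑ c_k e^{μ_k z}` is `∑ μ_k c_k e^{μ_k z}`. [folklore] -/
theorem hasDerivAt_expsum {ι : Type*} (s : Finset ι) (c μ : ι → ℂ) (z : ℂ) :
    HasDerivAt (fun z => ∑ k ∈ s, c k * cexp (μ k * z))
      (∑ k ∈ s, μ k * c k * cexp (μ k * z)) z := by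
  apply HasDerivAt.fun_sum
  intro k _
  have h1 : HasDerivAt (fun y : ℂ => μ k * y) (μ k) z := by
    simpa using (hasDerivAt_id z).const_mul (μ k)
  have h2 := ((Complex.hasDerivAt_exp (μ k * z)).comp z h1).const_mul (c k)
  exact h2.congr_deriv (by ring)

/-- `deriv` form of `hasDerivAt_expsum` for a spectrum `Λ ⊂ ℂ`. [folklore] -/
theorem deriv_expsum (Λ : Finset ℂ) (c : ℂ → ℂ) (z : ℂ) :
    deriv (fun z => ∑ l ∈ Λ, c l * cexp (l * z)) z = ∑ l ∈ Λ, l * c l * cexp (l * z) := by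
  have h := (hasDerivAt_expsum Λ c (fun l => l) z).deriv
  beta_reduce at h
  exact h

/-- **The pruning operator** `(D - a)` kills exactly the `a`-term:
`p'(z) - a p(z) = ∑_{λ ≠ a} (λ - a) c_λ e^{λ z}` (Friedland 2026, §4). [cite: Friedland2026DiskGrowthRemez, Lemma 4.2] -/
theorem prune_identity (Λ : Finset ℂ) (c : ℂ → ℂ) (a z : ℂ) :
    deriv (fun z => ∑ l ∈ Λ, c l * cexp (l * z)) z - a * ∑ l ∈ Λ, c l * cexp (l * z) =
      ∑ l ∈ Λ.erase a, (l - a) * c l * cexp (l * z) := by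
  classical
  rw [deriv_expsum, Finset.sum_erase Λ (f := fun l => (l - a) * c l * cexp (l * z)) (a := a)
    (by simp), Finset.mul_sum, ← Finset.sum_sub_distrib]
  refine Finset.sum_congr rfl fun l _ => ?_
  ring

/-- A reduced exponential sum (nonzero coefficients, distinct exponents, at least one term) does
not vanish identically (induction on the number of terms via the pruning operator; equivalently
Dedekind's independence of characters). [folklore] -/
theorem expsum_exists_ne_zero : ∀ (n : ℕ) (Λ : Finset ℂ) (c : ℂ → ℂ), Λ.card = n + 1 →
    (∀ l ∈ Λ, c l ≠ 0) → ∃ z : ℂ, ∑ l ∈ Λ, c l * cexp (l * z) ≠ 0 := by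
  classical
  intro n
  induction n with
  | zero =>
    intro Λ c hcard hc
    obtain ⟨a, rfl⟩ := Finset.card_eq_one.1 hcard
    exact ⟨0, by simpa using hc a (Finset.mem_singleton_self a)⟩
  | succ n ih =>
    intro Λ c hcard hc
    by_contra hall
    push Not at hall
    obtain ⟨a, ha⟩ : Λ.Nonempty := Finset.card_pos.1 (by omega)
    have hzero : ∀ z, ∑ l ∈ Λ.erase a, (l - a) * c l * cexp (l * z) = 0 := by
      intro z
      rw [← prune_identity Λ c a z]
      have hconst : (fun z => ∑ l ∈ Λ, c l * cexp (l * z)) = fun _ => (0 : ℂ) := funext hall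
      rw [hconst, deriv_const, hall z]
      ring
    obtain ⟨z, hz⟩ := ih (Λ.erase a) (fun l => (l - a) * c l)
      (by rw [Finset.card_erase_of_mem ha, hcard]; simp)
      (fun l hl => mul_ne_zero (sub_ne_zero.2 (Finset.ne_of_mem_erase hl))
        (hc l (Finset.mem_of_mem_erase hl)))
    exact hz (hzero z)

/-- Function form of `expsum_exists_ne_zero`. [folklore] -/
theorem expsum_ne_zero {Λ : Finset ℂ} (hΛ : Λ.Nonempty) {c : ℂ → ℂ} (hc : ∀ l ∈ Λ, c l ≠ 0) :
    (fun z : ℂ => ∑ l ∈ Λ, c l * cexp (l * z)) ≠ 0 := by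
  obtain ⟨z, hz⟩ := expsum_exists_ne_zero (Λ.card - 1) Λ c
    (by have := Finset.card_pos.2 hΛ; omega) hc
  exact fun h => hz (by simpa using congr_fun h z)

/-- The real zeros in `I₀` of an entire function `f ≠ 0` form a finite set (the "harmless finite
set" of the paper; from `extract_zeros`). [folklore] -/
theorem real_zeros_finite {f : ℂ → ℂ} (hf : ∀ z, AnalyticAt ℂ f z) (hf0 : f ≠ 0) :
    {t : ℝ | f t = 0 ∧ t ∈ Icc (-1 / 2 : ℝ) (1 / 2)}.Finite := by
  obtain ⟨Z, _, _, hZiff, -, -, -, -, -⟩ := extract_zeros hf hf0 0 (ρ := 2) (R₀ := 3) (by norm_num)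
  have h1 : {t : ℝ | f t = 0 ∧ t ∈ Icc (-1 / 2 : ℝ) (1 / 2)} ⊆ Complex.ofReal ⁻¹' (↑Z : Set ℂ) := by
    rintro t ⟨ht0, ht⟩
    show (t : ℂ) ∈ (↑Z : Set ℂ)
    rw [Finset.mem_coe, hZiff]
    refine ⟨ht0, ?_⟩
    rw [mem_closedBall, dist_zero_right, Complex.norm_real, Real.norm_eq_abs, abs_le]
    constructor <;> linarith [ht.1, ht.2]
  exact (Z.finite_toSet.preimage Complex.ofReal_injective.injOn).subset h1

/-- Almost every point of a set `E ⊆ I₀` is a non-zero of an entire `f ≠ 0`. [folklore] -/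
theorem ae_restrict_ne_zero {f : ℂ → ℂ} (hf : ∀ z, AnalyticAt ℂ f z) (hf0 : f ≠ 0)
    {E : Set ℝ} (hEm : MeasurableSet E) (hE : E ⊆ Icc (-1 / 2 : ℝ) (1 / 2)) :
    ∀ᵐ t : ℝ ∂(volume.restrict E), f t ≠ 0 := by
  rw [ae_restrict_iff' hEm]
  have : ∀ᵐ t ∂(volume : Measure ℝ), t ∉ {t : ℝ | f t = 0 ∧ t ∈ Icc (-1 / 2 : ℝ) (1 / 2)} :=
    measure_eq_zero_iff_ae_notMem.1 ((real_zeros_finite hf hf0).measure_zero volume)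
  filter_upwards [this] with t ht htE
  exact fun h => ht ⟨h, hE htE⟩

/-- A set `E ⊆ I₀` of positive measure contains a non-zero of an entire `f ≠ 0`. [folklore] -/
theorem exists_mem_ne_zero {f : ℂ → ℂ} (hf : ∀ z, AnalyticAt ℂ f z) (hf0 : f ≠ 0)
    {E : Set ℝ} (hE : E ⊆ Icc (-1 / 2 : ℝ) (1 / 2))
    (hEpos : 0 < (volume E).toReal) : ∃ t ∈ E, f t ≠ 0 := by
  by_contra hall
  push Not at hall
  have hsub : E ⊆ {t : ℝ | f t = 0 ∧ t ∈ Icc (-1 / 2 : ℝ) (1 / 2)} := fun t ht => ⟨hall t ht, hE ht⟩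
  have h0 : volume E = 0 := measure_mono_null hsub ((real_zeros_finite hf hf0).measure_zero volume)
  rw [h0, ENNReal.toReal_zero] at hEpos
  exact lt_irrefl _ hEpos

/-- An exponential sum is entire. [folklore] -/
theorem expsum_analyticAt {ι : Type*} (s : Finset ι) (c μ : ι → ℂ) (z : ℂ) :
    AnalyticAt ℂ (fun z => ∑ k ∈ s, c k * cexp (μ k * z)) z := by
  have hdiff : Differentiable ℂ fun z => ∑ k ∈ s, c k * cexp (μ k * z) := by fun_prop
  exact hdiff.analyticAt z


/-! ### Part 5c: integrability of `log |p|`, large-diameter pruning, single exponential factor -/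

/-- For every exponential sum `p` and measurable `E ⊆ I₀` of positive measure, `log|p|` is
integrable on `E` (`Real.log 0 = 0` takes care of the finitely many zeros): two or more terms by
`expsum_geometric_remez`, at most one term by continuity. [cite: Friedland2026DiskGrowthRemez, Thm 1.1] -/
theorem log_expsum_integrableOn (Λ : Finset ℂ) (c : ℂ → ℂ) {E : Set ℝ} (hEm : MeasurableSet E)
    (hE : E ⊆ Icc (-1 / 2 : ℝ) (1 / 2)) (hEpos : 0 < (volume E).toReal) :
    IntegrableOn (fun t : ℝ => Real.log ‖∑ l ∈ Λ, c l * cexp (l * t)‖) E := by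
  classical
  by_cases hn : 2 ≤ Λ.card
  · have hσ : ∀ l ∈ Λ, ‖l‖ ≤ ∑ l' ∈ Λ, ‖l'‖ := fun l hl =>
      Finset.single_le_sum (f := fun l' => ‖l'‖) (fun _ _ => norm_nonneg _) hl
    have h := (expsum_geometric_remez Λ c (fun l => l) hσ hn hEm hE hEpos).1
    beta_reduce at h
    exact h
  · have hcont : Continuous fun t : ℝ => Real.log ‖∑ l ∈ Λ, c l * cexp (l * t)‖ := by
      rcases Nat.lt_or_ge Λ.card 1 with h0 | h1
      · have : Λ = ∅ := Finset.card_eq_zero.1 (by omega)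
        subst this
        simp only [Finset.sum_empty, norm_zero, Real.log_zero]
        exact continuous_const
      · obtain ⟨l₀, hl₀⟩ := Finset.card_eq_one.1 (by omega : Λ.card = 1)
        subst hl₀
        simp only [Finset.sum_singleton]
        by_cases hc : c l₀ = 0
        · simp only [hc, zero_mul, norm_zero, Real.log_zero]
          exact continuous_const
        · exact Continuous.log (by fun_prop) fun t =>
            norm_ne_zero_iff.2 (mul_ne_zero hc (Complex.exp_ne_zero _))
    exact hcont.integrableOn_Icc.mono_set hE

/-- **Large-diameter pruning** (Friedland 2026, Lemma 4.2, explicit constant): if the spectrum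
`Λ` (`#Λ = n ≥ 2`) lies in `D̄(a,ρ)` with `ρ ≥ n`, then for `Q_a = ρ⁻¹(D-a)p` and every `u > 0`,
`|{t ∈ I₀ : p(t) ≠ 0, |Q_a(t)| > u|p(t)|}| ≤ 135000/u` (apply `weak_log_deriv` to
`g = e^{-at}p`, whose frequencies have modulus `≤ ρ`, at threshold `uρ`).
[cite: Friedland2026DiskGrowthRemez, Lemma 4.2] -/
theorem pruning_weak (Λ : Finset ℂ) (c : ℂ → ℂ) (hn : 2 ≤ Λ.card) (a : ℂ) {ρ : ℝ} (hρ : 0 < ρ)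
    (hΛρ : ∀ l ∈ Λ, ‖l - a‖ ≤ ρ) (hnρ : (Λ.card : ℝ) ≤ ρ)
    (hnz : ∃ x₁ : ℝ, x₁ ∈ Icc (-1 / 2 : ℝ) (1 / 2) ∧ ∑ l ∈ Λ, c l * cexp (l * x₁) ≠ 0)
    {u : ℝ} (hu : 0 < u) :
    volume {t : ℝ | t ∈ Icc (-1 / 2 : ℝ) (1 / 2) ∧ ∑ l ∈ Λ, c l * cexp (l * t) ≠ 0 ∧
      u < ‖∑ l ∈ Λ.erase a, (l - a) * c l * cexp (l * t)‖ /
        (ρ * ‖∑ l ∈ Λ, c l * cexp (l * t)‖)} ≤ ENNReal.ofReal (135000 / u) := by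
  classical
  set p : ℂ → ℂ := fun z => ∑ l ∈ Λ, c l * cexp (l * z) with hp
  have hpdef : ∀ z, ∑ l ∈ Λ, c l * cexp (l * z) = p z := fun z => rfl
  simp only [hpdef] at hnz ⊢
  set g : ℂ → ℂ := fun z => ∑ l ∈ Λ, c l * cexp ((l - a) * z) with hg
  have hgp : ∀ z, g z = cexp (-(a * z)) * p z := by
    intro z
    simp only [hg, ← hpdef, Finset.mul_sum]
    refine Finset.sum_congr rfl fun l _ => ?_
    rw [show (l - a) * z = l * z + -(a * z) by ring, Complex.exp_add]; ring
  have hga : ∀ z, AnalyticAt ℂ g z := fun z => expsum_analyticAt Λ c (fun l => l - a) z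
  have hdg : ∀ z, deriv g z =
      cexp (-(a * z)) * ∑ l ∈ Λ.erase a, (l - a) * c l * cexp (l * z) := by
    intro z
    have h1 := (hasDerivAt_expsum Λ c (fun l => l - a) z).deriv
    beta_reduce at h1
    rw [h1, ← Finset.sum_erase Λ (f := fun l => (l - a) * c l * cexp ((l - a) * z)) (a := a)
      (by simp), Finset.mul_sum]
    refine Finset.sum_congr rfl fun l _ => ?_
    rw [show (l - a) * z = l * z + -(a * z) by ring, Complex.exp_add]; ring
  -- disk growth for `g` and the weak estimate at threshold `uρ`
  have hDG := expsum_disk_growth_hyp Λ c (fun l => l - a) hΛρ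
  obtain ⟨x₁, hx₁, hpx₁⟩ := hnz
  have hgx₁ : g x₁ ≠ 0 := by rw [hgp]; exact mul_ne_zero (Complex.exp_ne_zero _) hpx₁
  have hd1 : 1 ≤ Λ.card - 1 := by omega
  have hlog4 : 0 ≤ Real.log 4 := Real.log_nonneg (by norm_num)
  have hW := weak_log_deriv hga (a := 2 * ρ) (b := ((Λ.card - 1 : ℕ) : ℝ) * (1 + Real.log 4))
    (d := Λ.card - 1) (by positivity) (by positivity) hd1 hDG ⟨x₁, hx₁, hgx₁⟩ (u := u * ρ)
    (by positivity)
  have hset : {t : ℝ | t ∈ Icc (-1 / 2 : ℝ) (1 / 2) ∧ p t ≠ 0 ∧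
      u < ‖∑ l ∈ Λ.erase a, (l - a) * c l * cexp (l * t)‖ / (ρ * ‖p t‖)} ⊆
      {t : ℝ | t ∈ Icc (-1 / 2 : ℝ) (1 / 2) ∧ g t ≠ 0 ∧ u * ρ < ‖deriv g t / g t‖} := by
    rintro t ⟨ht, hpt, hut⟩
    have hgt : g t ≠ 0 := by rw [hgp]; exact mul_ne_zero (Complex.exp_ne_zero _) hpt
    refine ⟨ht, hgt, ?_⟩
    have hnorm : ‖deriv g t / g t‖ = ‖∑ l ∈ Λ.erase a, (l - a) * c l * cexp (l * t)‖ / ‖p t‖ := by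
      rw [hdg, hgp, norm_div, norm_mul, norm_mul,
        mul_div_mul_left _ _ (norm_ne_zero_iff.2 (Complex.exp_ne_zero _))]
    rw [hnorm]
    have hpt' : 0 < ‖p t‖ := norm_pos_iff.2 hpt
    rw [lt_div_iff₀ (by positivity)] at hut
    rw [lt_div_iff₀ hpt', mul_assoc]
    exact hut
  calc volume _ ≤ volume _ := measure_mono hset
    _ ≤ _ := hW
    _ ≤ ENNReal.ofReal (135000 / u) := by
        apply ENNReal.ofReal_le_ofReal
        rw [div_le_div_iff₀ (by positivity) hu]
        have hlog4' : Real.log 4 ≤ 7 / 5 := by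
          have : Real.log 4 = 2 * Real.log 2 := by
            rw [show (4 : ℝ) = 2 ^ 2 by norm_num, Real.log_pow]; norm_num
          rw [this]; linarith [Real.log_two_lt_d9]
        have hk0 : (0 : ℝ) ≤ ((Λ.card - 1 : ℕ) : ℝ) := Nat.cast_nonneg _
        have hcard : ((Λ.card - 1 : ℕ) : ℝ) ≤ ρ := by
          have : ((Λ.card - 1 : ℕ) : ℝ) ≤ Λ.card := by exact_mod_cast Nat.sub_le _ _
          linarith
        have h1 : ((Λ.card - 1 : ℕ) : ℝ) * (1 + Real.log 4) + ((Λ.card - 1 : ℕ) : ℝ) ≤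
            17 / 5 * ρ := by nlinarith
        nlinarith [mul_le_mul_of_nonneg_right h1 hu.le, hu.le, hρ.le]

/-- **Geometric quotient control** (Friedland 2026, Lemma 4.3, abstract form): if
`|{t ∈ I₀ : φ ≠ 0, ψ/φ > u}| ≤ C/u` for all `u > 0` (`C ≥ 1`), `φ, ψ ≥ 0` are a.e. non-zero on
`E ⊆ I₀` (`|E| = α > 0`) with `log φ, log ψ ∈ L¹(E)`, then
`∫_E log ψ ≤ ∫_E log φ + α (log(2C/α) + 1)` — the distribution-function bound for `log⁺(ψ/φ)`,
here through `geometric_mean_bound` with `d = 1` applied to `F = 1/max(1, ψ/φ)`.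
[cite: Friedland2026DiskGrowthRemez, Lemma 4.3] -/
theorem geometric_quotient_control {φ ψ : ℝ → ℝ} (hφm : Measurable φ) (hψm : Measurable ψ)
    (hφ0 : ∀ x, 0 ≤ φ x) (hψ0 : ∀ x, 0 ≤ ψ x) {C : ℝ} (hC : 1 ≤ C)
    (hweak : ∀ u : ℝ, 0 < u →
      volume {t : ℝ | t ∈ Icc (-1 / 2 : ℝ) (1 / 2) ∧ φ t ≠ 0 ∧ u < ψ t / φ t} ≤
        ENNReal.ofReal (C / u))
    {E : Set ℝ} (hEm : MeasurableSet E) (hE : E ⊆ Icc (-1 / 2 : ℝ) (1 / 2))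
    (hEpos : 0 < (volume E).toReal)
    (hφE : ∀ᵐ t ∂(volume.restrict E), φ t ≠ 0) (hψE : ∀ᵐ t ∂(volume.restrict E), ψ t ≠ 0)
    (hφi : IntegrableOn (fun t => Real.log (φ t)) E)
    (hψi : IntegrableOn (fun t => Real.log (ψ t)) E) :
    ∫ t in E, Real.log (ψ t) ≤
      (∫ t in E, Real.log (φ t)) +
        (volume E).toReal * (Real.log (2 * C / (volume E).toReal) + 1) := by
  set α := (volume E).toReal with hα
  set F : ℝ → ℝ := fun x => (max 1 (ψ x / φ x))⁻¹ with hF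
  have hFm : Measurable F := (measurable_const.max (hψm.div hφm)).inv
  have hmax1 : ∀ x, 1 ≤ max 1 (ψ x / φ x) := fun x => le_max_left _ _
  have hF0 : ∀ x ∈ Icc (-1 / 2 : ℝ) (1 / 2), 0 ≤ F x := fun x _ =>
    inv_nonneg.2 (zero_le_one.trans (hmax1 x))
  have hF1 : ∀ x ∈ Icc (-1 / 2 : ℝ) (1 / 2), F x ≤ 1 := fun x _ => inv_le_one_of_one_le₀ (hmax1 x)
  have hsub : ∀ ε : ℝ, 0 < ε → volume {x ∈ Icc (-1 / 2 : ℝ) (1 / 2) | F x ≤ ε} ≤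
      ENNReal.ofReal (2 * C * ε ^ (1 / (1 : ℕ) : ℝ)) := by
    intro ε hε
    rw [Nat.cast_one, div_one, Real.rpow_one]
    by_cases hε1 : 1 ≤ ε
    · calc volume {x ∈ Icc (-1 / 2 : ℝ) (1 / 2) | F x ≤ ε} ≤ volume (Icc (-1 / 2 : ℝ) (1 / 2)) :=
            measure_mono fun x hx => hx.1
        _ = 1 := by rw [Real.volume_Icc]; norm_num
        _ ≤ ENNReal.ofReal (2 * C * ε) := by
            rw [← ENNReal.ofReal_one]
            apply ENNReal.ofReal_le_ofReal
            nlinarith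
    · push Not at hε1
      have hsub' : {x ∈ Icc (-1 / 2 : ℝ) (1 / 2) | F x ≤ ε} ⊆
          {t : ℝ | t ∈ Icc (-1 / 2 : ℝ) (1 / 2) ∧ φ t ≠ 0 ∧ 1 / (2 * ε) < ψ t / φ t} := by
        rintro x ⟨hx, hFx⟩
        have hFx' : (max 1 (ψ x / φ x))⁻¹ ≤ ε := hFx
        have hm : ε⁻¹ ≤ max 1 (ψ x / φ x) :=
          (inv_le_comm₀ (lt_of_lt_of_le zero_lt_one (hmax1 x)) hε).1 hFx'
        have hinv : 1 < ε⁻¹ := (one_lt_inv₀ hε).2 hε1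
        have hr : ε⁻¹ ≤ ψ x / φ x := by
          rcases le_max_iff.1 hm with h | h
          · exact absurd h (not_le.2 hinv)
          · exact h
        have hφx : φ x ≠ 0 := by
          intro h0
          rw [h0, div_zero] at hr
          linarith [inv_pos.2 hε]
        refine ⟨hx, hφx, lt_of_lt_of_le ?_ hr⟩
        rw [div_lt_iff₀ (by positivity), show ε⁻¹ * (2 * ε) = 2 by field_simp]
        norm_num
      calc volume _ ≤ volume _ := measure_mono hsub'
        _ ≤ ENNReal.ofReal (C / (1 / (2 * ε))) := hweak _ (by positivity)
        _ = ENNReal.ofReal (2 * C * ε) := by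
            congr 1
            field_simp
  obtain ⟨hlogF, hintF⟩ :=
    geometric_mean_bound (d := 1) le_rfl (A := 2 * C) (by linarith) hFm hF0 hF1 hsub hEm hE hEpos
  have hae : ∀ᵐ t ∂(volume.restrict E), Real.log (ψ t) ≤ Real.log (φ t) + -Real.log (F t) := by
    filter_upwards [hφE, hψE] with t hφt hψt
    have hφpos : 0 < φ t := lt_of_le_of_ne (hφ0 t) (Ne.symm hφt)
    have hψpos : 0 < ψ t := lt_of_le_of_ne (hψ0 t) (Ne.symm hψt)
    have h0 : Real.log (F t) = -Real.log (max 1 (ψ t / φ t)) := by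
      simp only [hF, Real.log_inv]
    have h1 : Real.log (ψ t) - Real.log (φ t) = Real.log (ψ t / φ t) :=
      (Real.log_div hψt hφt).symm
    have h2 : Real.log (ψ t / φ t) ≤ Real.log (max 1 (ψ t / φ t)) :=
      Real.log_le_log (div_pos hψpos hφpos) (le_max_right _ _)
    rw [h0, neg_neg]
    linarith
  have hnegF : Integrable (fun t => -Real.log (F t)) (volume.restrict E) := hlogF.fun_neg
  have hsum : Integrable (fun t => Real.log (φ t) + -Real.log (F t)) (volume.restrict E) :=
    hφi.add hnegF
  have hint := integral_mono_ae hψi hsum hae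
  rw [integral_add hφi hnegF, integral_neg] at hint
  have hintF' : -(∫ x in E, Real.log (F x)) ≤ α * (Real.log (2 * C / α) + 1) := by
    have := hintF
    simp only [Nat.cast_one, one_mul] at this
    exact this
  linarith

/-- **Single exponential factor** (Friedland 2026, Lemma 3.3): with `F(t) = e^{-λ₀ t} p(t)` one
has `G_E(F) = e^{-Re λ₀ · avg_E} G_E(p)` and hence a bound `sup_{I₀}|F| ≤ B · G_E(F)` yields
`sup_{I₀}|p| ≤ e^{|Re λ₀|} B · G_E(p)`. [cite: Friedland2026DiskGrowthRemez, Lemma 3.3] -/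
theorem single_exponential_factor (Λ : Finset ℂ) (c : ℂ → ℂ) (l₀ : ℂ)
    (hp0 : (fun z : ℂ => ∑ l ∈ Λ, c l * cexp (l * z)) ≠ 0) {B : ℝ} (hB : 0 ≤ B)
    {E : Set ℝ} (hEm : MeasurableSet E) (hE : E ⊆ Icc (-1 / 2 : ℝ) (1 / 2))
    (hEpos : 0 < (volume E).toReal)
    (hF : ∀ t ∈ Icc (-1 / 2 : ℝ) (1 / 2), ‖∑ l ∈ Λ, c l * cexp ((l - l₀) * t)‖ ≤
      B * Real.exp ((volume E).toReal⁻¹ *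
        ∫ s in E, Real.log ‖∑ l ∈ Λ, c l * cexp ((l - l₀) * s)‖)) :
    ∀ t ∈ Icc (-1 / 2 : ℝ) (1 / 2), ‖∑ l ∈ Λ, c l * cexp (l * t)‖ ≤
      Real.exp |l₀.re| * B *
        Real.exp ((volume E).toReal⁻¹ * ∫ s in E, Real.log ‖∑ l ∈ Λ, c l * cexp (l * s)‖) := by
  classical
  set α := (volume E).toReal with hα
  set p : ℂ → ℂ := fun z => ∑ l ∈ Λ, c l * cexp (l * z) with hp
  have hpdef : ∀ z, ∑ l ∈ Λ, c l * cexp (l * z) = p z := fun z => rfl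
  simp only [hpdef]
  have hFp : ∀ z, ∑ l ∈ Λ, c l * cexp ((l - l₀) * z) = cexp (-(l₀ * z)) * p z := by
    intro z
    simp only [← hpdef, Finset.mul_sum]
    refine Finset.sum_congr rfl fun l _ => ?_
    rw [show (l - l₀) * z = l * z + -(l₀ * z) by ring, Complex.exp_add]; ring
  have hnorm : ∀ s : ℝ, ‖∑ l ∈ Λ, c l * cexp ((l - l₀) * s)‖ = Real.exp (-(l₀.re * s)) * ‖p s‖ := by
    intro s
    rw [hFp, norm_mul, Complex.norm_exp]
    congr 2
    simp [Complex.mul_re]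
  have hpa : ∀ z, AnalyticAt ℂ p z := fun z => expsum_analyticAt Λ c (fun l => l) z
  have hae : ∀ᵐ s : ℝ ∂(volume.restrict E),
      Real.log ‖∑ l ∈ Λ, c l * cexp ((l - l₀) * s)‖ = -(l₀.re * s) + Real.log ‖p s‖ := by
    filter_upwards [ae_restrict_ne_zero hpa hp0 hEm hE] with s hs
    rw [hnorm, Real.log_mul (Real.exp_pos _).ne' (norm_ne_zero_iff.2 hs), Real.log_exp]
  have hEfin : volume E ≠ ⊤ := by
    intro h; rw [hα, h, ENNReal.toReal_top] at hEpos; exact lt_irrefl _ hEpos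
  have hlin : IntegrableOn (fun s : ℝ => -(l₀.re * s)) E :=
    ((continuous_const.mul continuous_id).neg.integrableOn_Icc).mono_set hE
  have hlogp : IntegrableOn (fun s : ℝ => Real.log ‖p s‖) E :=
    log_expsum_integrableOn Λ c hEm hE hEpos
  set I : ℝ := ∫ s in E, Real.log ‖p s‖ with hI
  set J : ℝ := ∫ s in E, (s : ℝ) with hJ
  have hint_eq : ∫ s in E, Real.log ‖∑ l ∈ Λ, c l * cexp ((l - l₀) * s)‖ = -(l₀.re * J) + I := by
    rw [integral_congr_ae hae, integral_add hlin hlogp, integral_neg, integral_const_mul]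
  have havg : |J| ≤ 1 / 2 * α := by
    have h := norm_setIntegral_le_of_norm_le_const hEfin.lt_top
      (fun s hs => ?_ : ∀ s ∈ E, ‖(s : ℝ)‖ ≤ 1 / 2) (f := fun s : ℝ => s) (μ := volume)
    · rw [Real.norm_eq_abs] at h
      exact h
    · rw [Real.norm_eq_abs, abs_le]
      constructor <;> linarith [(hE hs).1, (hE hs).2]
  intro t ht
  have h1 : ‖p t‖ = Real.exp (l₀.re * t) * ‖∑ l ∈ Λ, c l * cexp ((l - l₀) * t)‖ := by
    rw [hnorm, ← mul_assoc, ← Real.exp_add, add_neg_cancel, Real.exp_zero, one_mul]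
  have havg' : |t - α⁻¹ * J| ≤ 1 := by
    have ht' : |t| ≤ 1 / 2 := abs_le.2 ⟨by linarith [ht.1], ht.2⟩
    have hJ' : |α⁻¹ * J| ≤ 1 / 2 := by
      rw [abs_mul, abs_inv, abs_of_pos hEpos, inv_mul_le_iff₀ hEpos]
      linarith
    calc |t - α⁻¹ * J| ≤ |t| + |α⁻¹ * J| := abs_sub _ _
      _ ≤ 1 := by linarith
  have hexp : Real.exp (l₀.re * t) * Real.exp (α⁻¹ * (-(l₀.re * J) + I)) ≤
      Real.exp |l₀.re| * Real.exp (α⁻¹ * I) := by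
    rw [← Real.exp_add, ← Real.exp_add]
    apply Real.exp_le_exp.2
    have h3 : l₀.re * t + α⁻¹ * (-(l₀.re * J) + I) = l₀.re * (t - α⁻¹ * J) + α⁻¹ * I := by ring
    rw [h3]
    have h2 : l₀.re * (t - α⁻¹ * J) ≤ |l₀.re| := by
      calc l₀.re * (t - α⁻¹ * J) ≤ |l₀.re * (t - α⁻¹ * J)| := le_abs_self _
        _ = |l₀.re| * |t - α⁻¹ * J| := abs_mul _ _
        _ ≤ |l₀.re| * 1 := by gcongr
        _ = |l₀.re| := mul_one _
    linarith
  calc ‖p t‖ = Real.exp (l₀.re * t) * ‖∑ l ∈ Λ, c l * cexp ((l - l₀) * t)‖ := h1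
    _ ≤ Real.exp (l₀.re * t) * (B * Real.exp (α⁻¹ *
          ∫ s in E, Real.log ‖∑ l ∈ Λ, c l * cexp ((l - l₀) * s)‖)) := by
        gcongr; exact hF t ht
    _ = B * (Real.exp (l₀.re * t) * Real.exp (α⁻¹ * (-(l₀.re * J) + I))) := by
        rw [hint_eq]; ring
    _ ≤ B * (Real.exp |l₀.re| * Real.exp (α⁻¹ * I)) := by gcongr
    _ = Real.exp |l₀.re| * B * Real.exp (α⁻¹ * I) := by ring


/-! ### Part 5d: the geometric-mean induction (Friedland 2026, Thm 5.1) -/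

/-- **Geometric quotient control for the pruned sum** (Friedland 2026, Lemmas 4.2–4.3 combined, explicit
constant): for a reduced exponential sum `p` with `n ≥ 2` terms and spectrum in `D̄(a,ρ)`, `a ∈ Λ`,
`ρ ≥ n`, the pruned sum `Q_a = ρ⁻¹(D-a)p` satisfies `∫_E log|Q_a| ≤ ∫_E log|p| + α(log(270000/α)+1)`
for every measurable `E ⊆ I₀` with `|E| = α > 0`, i.e. `G_E(Q_a) ≤ (270000e/α) G_E(p)`.
[cite: Friedland2026DiskGrowthRemez, Lemma 4.3] -/
theorem pruning_step (Λ : Finset ℂ) (c : ℂ → ℂ) (hn : 2 ≤ Λ.card) (hc : ∀ l ∈ Λ, c l ≠ 0)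
    {a : ℂ} (ha : a ∈ Λ) {ρ : ℝ} (hρ : 0 < ρ) (hΛρ : ∀ l ∈ Λ, ‖l - a‖ ≤ ρ)
    (hnρ : (Λ.card : ℝ) ≤ ρ) {E : Set ℝ} (hEm : MeasurableSet E)
    (hE : E ⊆ Icc (-1 / 2 : ℝ) (1 / 2)) (hEpos : 0 < (volume E).toReal) :
    ∫ s in E, Real.log ‖∑ l ∈ Λ.erase a, (ρ : ℂ)⁻¹ * ((l - a) * c l) * cexp (l * s)‖ ≤
      (∫ s in E, Real.log ‖∑ l ∈ Λ, c l * cexp (l * s)‖) +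
        (volume E).toReal * (Real.log (270000 / (volume E).toReal) + 1) := by
  classical
  set p : ℂ → ℂ := fun z => ∑ l ∈ Λ, c l * cexp (l * z) with hp
  have hpdef : ∀ z, ∑ l ∈ Λ, c l * cexp (l * z) = p z := fun z => rfl
  set Q : ℂ → ℂ := fun z => ∑ l ∈ Λ.erase a, (ρ : ℂ)⁻¹ * ((l - a) * c l) * cexp (l * z) with hQ
  have hQdef : ∀ z, ∑ l ∈ Λ.erase a, (ρ : ℂ)⁻¹ * ((l - a) * c l) * cexp (l * z) = Q z :=
    fun z => rfl
  simp only [hpdef, hQdef]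
  have hΛne : Λ.Nonempty := Finset.card_pos.1 (by omega)
  have hp0 : p ≠ 0 := expsum_ne_zero hΛne hc
  have hQne : (Λ.erase a).Nonempty :=
    Finset.card_pos.1 (by rw [Finset.card_erase_of_mem ha]; omega)
  have hcQ : ∀ l ∈ Λ.erase a, (ρ : ℂ)⁻¹ * ((l - a) * c l) ≠ 0 := fun l hl =>
    mul_ne_zero (inv_ne_zero (Complex.ofReal_ne_zero.2 hρ.ne'))
      (mul_ne_zero (sub_ne_zero.2 (Finset.ne_of_mem_erase hl))
        (hc l (Finset.mem_of_mem_erase hl)))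
  have hQ0 : Q ≠ 0 := expsum_ne_zero hQne hcQ
  have hpa : ∀ z, AnalyticAt ℂ p z := fun z => expsum_analyticAt Λ c (fun l => l) z
  have hQa : ∀ z, AnalyticAt ℂ Q z := fun z =>
    expsum_analyticAt (Λ.erase a) (fun l => (ρ : ℂ)⁻¹ * ((l - a) * c l)) (fun l => l) z
  have hQD : ∀ z, Q z = (ρ : ℂ)⁻¹ * ∑ l ∈ Λ.erase a, (l - a) * c l * cexp (l * z) := fun z => by
    simp only [← hQdef, Finset.mul_sum]
    exact Finset.sum_congr rfl fun l _ => by ring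
  obtain ⟨x₁, hx₁E, hpx₁⟩ := exists_mem_ne_zero hpa hp0 hE hEpos
  have hweak : ∀ u : ℝ, 0 < u →
      volume {t : ℝ | t ∈ Icc (-1 / 2 : ℝ) (1 / 2) ∧ ‖p t‖ ≠ 0 ∧ u < ‖Q t‖ / ‖p t‖} ≤
        ENNReal.ofReal (135000 / u) := by
    intro u hu
    have h := pruning_weak Λ c hn a hρ hΛρ hnρ ⟨x₁, hE hx₁E, hpx₁⟩ hu
    simp only [hpdef] at h
    have hset : {t : ℝ | t ∈ Icc (-1 / 2 : ℝ) (1 / 2) ∧ ‖p t‖ ≠ 0 ∧ u < ‖Q t‖ / ‖p t‖} =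
        {t : ℝ | t ∈ Icc (-1 / 2 : ℝ) (1 / 2) ∧ p t ≠ 0 ∧
          u < ‖∑ l ∈ Λ.erase a, (l - a) * c l * cexp (l * t)‖ / (ρ * ‖p t‖)} := by
      ext t
      simp only [Set.mem_setOf_eq, norm_ne_zero_iff, hQD, norm_mul, norm_inv, Complex.norm_real,
        Real.norm_eq_abs, abs_of_pos hρ]
      rw [inv_mul_eq_div, div_div]
    rw [hset]
    exact h
  have hpc : Continuous fun t : ℝ => p t := by simp only [← hpdef]; fun_prop
  have hQc : Continuous fun t : ℝ => Q t := by simp only [← hQdef]; fun_prop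
  have key := geometric_quotient_control (φ := fun t : ℝ => ‖p t‖) (ψ := fun t : ℝ => ‖Q t‖)
    (continuous_norm.comp hpc).measurable (continuous_norm.comp hQc).measurable
    (fun _ => norm_nonneg _) (fun _ => norm_nonneg _) (C := 135000) (by norm_num) hweak hEm hE
    hEpos ((ae_restrict_ne_zero hpa hp0 hEm hE).mono fun t ht => norm_ne_zero_iff.2 ht)
    ((ae_restrict_ne_zero hQa hQ0 hEm hE).mono fun t ht => norm_ne_zero_iff.2 ht)
    (log_expsum_integrableOn Λ c hEm hE hEpos)
    (log_expsum_integrableOn (Λ.erase a) (fun l => (ρ : ℂ)⁻¹ * ((l - a) * c l)) hEm hE hEpos)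
  have h2 : (2 : ℝ) * 135000 = 270000 := by norm_num
  rw [h2] at key
  exact key

/-- **Normalized geometric Turán–Nazarov estimate** (Friedland 2026, Thm 5.1, explicit constant
`C = e^{16000}`): for a reduced exponential sum `p(t) = ∑_{λ∈Λ} c_λ e^{λt}` with `#Λ = n+1`
nonzero terms, `M = max |Re λ|`, and measurable `E ⊆ I₀` with `|E| = α > 0`,
`sup_{I₀}|p| ≤ e^{M} (C/α)^n exp(α⁻¹∫_E log|p|) = e^M (C/α)^n G_E(p)`.
Induction on `n`: one term by Lemma 3.3; diameter `≤ n+1` by Cor 3.4 + Lemma 3.3; otherwise prune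
the two farthest exponents (`|p| ≤ |Q_a| + |Q_b|`) and use `pruning_step` on the ORIGINAL set `E`.
[cite: Friedland2026DiskGrowthRemez, Thm 5.1] -/
theorem geometric_turan_nazarov : ∀ (n : ℕ) (Λ : Finset ℂ) (c : ℂ → ℂ), Λ.card = n + 1 →
    (∀ l ∈ Λ, c l ≠ 0) → ∀ (MRe : ℝ), (∀ l ∈ Λ, |l.re| ≤ MRe) →
    ∀ (E : Set ℝ), MeasurableSet E → E ⊆ Icc (-1 / 2 : ℝ) (1 / 2) → 0 < (volume E).toReal →
    ∀ t ∈ Icc (-1 / 2 : ℝ) (1 / 2), ‖∑ l ∈ Λ, c l * cexp (l * t)‖ ≤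
      Real.exp MRe * (Real.exp 16000 / (volume E).toReal) ^ n *
        Real.exp ((volume E).toReal⁻¹ * ∫ s in E, Real.log ‖∑ l ∈ Λ, c l * cexp (l * s)‖) := by
  classical
  intro n
  induction n with
  | zero =>
    intro Λ c hcard hc MRe hMRe E hEm hE hEpos t ht
    obtain ⟨l₀, rfl⟩ := Finset.card_eq_one.1 hcard
    have hc0 : c l₀ ≠ 0 := hc l₀ (Finset.mem_singleton_self l₀)
    have hp0 := expsum_ne_zero (Finset.singleton_nonempty l₀) hc
    have hF : ∀ t ∈ Icc (-1 / 2 : ℝ) (1 / 2),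
        ‖∑ l ∈ ({l₀} : Finset ℂ), c l * cexp ((l - l₀) * t)‖ ≤
          1 * Real.exp ((volume E).toReal⁻¹ *
            ∫ s in E, Real.log ‖∑ l ∈ ({l₀} : Finset ℂ), c l * cexp ((l - l₀) * s)‖) := by
      intro t _
      simp only [Finset.sum_singleton, sub_self, zero_mul, Complex.exp_zero, mul_one]
      rw [setIntegral_const, smul_eq_mul, measureReal_def, ← mul_assoc,
        inv_mul_cancel₀ hEpos.ne', one_mul, one_mul, Real.exp_log (norm_pos_iff.2 hc0)]
    have h := single_exponential_factor {l₀} c l₀ hp0 zero_le_one hEm hE hEpos hF t ht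
    calc _ ≤ _ := h
      _ ≤ _ := by
          rw [pow_zero]
          gcongr
          exact hMRe l₀ (Finset.mem_singleton_self l₀)
  | succ n ih =>
    intro Λ c hcard hc MRe hMRe E hEm hE hEpos t ht
    set α : ℝ := (volume E).toReal with hα
    have hn2 : 2 ≤ Λ.card := by omega
    have hΛne : Λ.Nonempty := Finset.card_pos.1 (by omega)
    have hp0 := expsum_ne_zero hΛne hc
    -- two farthest exponents `a, b`, `ρ = diam Λ = |a - b|`
    obtain ⟨q, hq, hqmax⟩ := Finset.exists_max_image (Λ ×ˢ Λ) (fun q : ℂ × ℂ => ‖q.1 - q.2‖)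
      (hΛne.product hΛne)
    obtain ⟨ha, hb⟩ := Finset.mem_product.1 hq
    set a : ℂ := q.1 with hqa
    set b : ℂ := q.2 with hqb
    set ρ : ℝ := ‖a - b‖ with hρdef
    have hdiam : ∀ l ∈ Λ, ∀ l' ∈ Λ, ‖l - l'‖ ≤ ρ := fun l hl l' hl' =>
      hqmax (l, l') (Finset.mem_product.2 ⟨hl, hl'⟩)
    set G : ℝ := Real.exp (α⁻¹ * ∫ s in E, Real.log ‖∑ l ∈ Λ, c l * cexp (l * s)‖) with hG
    by_cases hmod : ρ ≤ (n + 2 : ℝ)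
    · -- moderate diameter: Cor 3.4 for `e^{-at} p(t)` and Lemma 3.3
      have hσ : ∀ l ∈ Λ, ‖l - a‖ ≤ (n + 2 : ℝ) := fun l hl => (hdiam l hl a ha).trans hmod
      have key := expsum_geometric_remez Λ c (fun l => l - a) hσ hn2 hEm hE hEpos
      have hB : 0 ≤ Real.exp (4216 * (n + 2 : ℝ)) * (Real.exp 7200 / α) ^ (Λ.card - 1) := by
        positivity
      have hF : ∀ t ∈ Icc (-1 / 2 : ℝ) (1 / 2), ‖∑ l ∈ Λ, c l * cexp ((l - a) * t)‖ ≤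
          Real.exp (4216 * (n + 2 : ℝ)) * (Real.exp 7200 / α) ^ (Λ.card - 1) *
            Real.exp (α⁻¹ * ∫ s in E, Real.log ‖∑ l ∈ Λ, c l * cexp ((l - a) * s)‖) := by
        intro t ht
        have := key.2 t ht
        beta_reduce at this
        exact this
      have h33 := single_exponential_factor Λ c a hp0 hB hEm hE hEpos hF t ht
      rw [hcard, show n + 1 + 1 - 1 = n + 1 by omega] at h33
      have hexpm : Real.exp (4216 * (n + 2 : ℝ)) ≤ Real.exp 8800 ^ (n + 1) := by
        rw [← Real.exp_nat_mul]
        apply Real.exp_le_exp.2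
        push_cast
        nlinarith
      have hBle : Real.exp (4216 * (n + 2 : ℝ)) * (Real.exp 7200 / α) ^ (n + 1) ≤
          (Real.exp 16000 / α) ^ (n + 1) := by
        calc _ ≤ Real.exp 8800 ^ (n + 1) * (Real.exp 7200 / α) ^ (n + 1) := by gcongr
          _ = (Real.exp 8800 * (Real.exp 7200 / α)) ^ (n + 1) := (mul_pow _ _ _).symm
          _ = (Real.exp 16000 / α) ^ (n + 1) := by
              rw [mul_div_assoc', ← Real.exp_add]; norm_num
      have hea : Real.exp |a.re| ≤ Real.exp MRe := Real.exp_le_exp.2 (hMRe a ha)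
      have hB' : 0 ≤ Real.exp (4216 * (n + 2 : ℝ)) * (Real.exp 7200 / α) ^ (n + 1) := by
        positivity
      calc _ ≤ _ := h33
        _ ≤ Real.exp MRe * (Real.exp 16000 / α) ^ (n + 1) * G := by
            apply mul_le_mul_of_nonneg_right _ (Real.exp_pos _).le
            exact mul_le_mul hea hBle hB' (Real.exp_pos _).le
    · -- large diameter: prune `a` and `b`
      push Not at hmod
      have hρ : 0 < ρ := lt_of_le_of_lt (by positivity) hmod
      have hnρ : (Λ.card : ℝ) ≤ ρ := by rw [hcard]; push_cast; linarith
      have hab' : 0 < ‖a - b‖ := by rw [← hρdef]; exact hρ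
      have hcardA : (Λ.erase a).card = n + 1 := by simp [Finset.card_erase_of_mem ha, hcard]
      have hcardB : (Λ.erase b).card = n + 1 := by simp [Finset.card_erase_of_mem hb, hcard]
      have hcoef : ∀ e ∈ Λ, ∀ l ∈ Λ.erase e, (ρ : ℂ)⁻¹ * ((l - e) * c l) ≠ 0 := fun e _ l hl =>
        mul_ne_zero (inv_ne_zero (Complex.ofReal_ne_zero.2 hρ.ne'))
          (mul_ne_zero (sub_ne_zero.2 (Finset.ne_of_mem_erase hl))
            (hc l (Finset.mem_of_mem_erase hl)))
      have IHa := ih (Λ.erase a) (fun l => (ρ : ℂ)⁻¹ * ((l - a) * c l)) hcardA (hcoef a ha) MRe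
        (fun l hl => hMRe l (Finset.mem_of_mem_erase hl)) E hEm hE hEpos t ht
      have IHb := ih (Λ.erase b) (fun l => (ρ : ℂ)⁻¹ * ((l - b) * c l)) hcardB (hcoef b hb) MRe
        (fun l hl => hMRe l (Finset.mem_of_mem_erase hl)) E hEm hE hEpos t ht
      beta_reduce at IHa IHb
      have PSa := pruning_step Λ c hn2 hc ha hρ (fun l hl => hdiam l hl a ha) hnρ hEm hE hEpos
      have PSb := pruning_step Λ c hn2 hc hb hρ (fun l hl => hdiam l hl b hb) hnρ hEm hE hEpos
      -- `|p| ≤ |Q_a| + |Q_b|`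
      have hsplit : ∀ z : ℂ, ‖∑ l ∈ Λ, c l * cexp (l * z)‖ ≤
          ‖∑ l ∈ Λ.erase a, (ρ : ℂ)⁻¹ * ((l - a) * c l) * cexp (l * z)‖ +
            ‖∑ l ∈ Λ.erase b, (ρ : ℂ)⁻¹ * ((l - b) * c l) * cexp (l * z)‖ := by
        intro z
        have hQdiff : ∑ l ∈ Λ.erase a, (ρ : ℂ)⁻¹ * ((l - a) * c l) * cexp (l * z) -
            ∑ l ∈ Λ.erase b, (ρ : ℂ)⁻¹ * ((l - b) * c l) * cexp (l * z) =
            (ρ : ℂ)⁻¹ * (b - a) * ∑ l ∈ Λ, c l * cexp (l * z) := by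
          rw [Finset.sum_erase Λ (f := fun l => (ρ : ℂ)⁻¹ * ((l - a) * c l) * cexp (l * z))
              (by simp),
            Finset.sum_erase Λ (f := fun l => (ρ : ℂ)⁻¹ * ((l - b) * c l) * cexp (l * z))
              (by simp), ← Finset.sum_sub_distrib, Finset.mul_sum]
          refine Finset.sum_congr rfl fun l _ => ?_
          ring
        have h1 : ‖(ρ : ℂ)⁻¹ * (b - a)‖ = 1 := by
          rw [norm_mul, norm_inv, Complex.norm_real, Real.norm_eq_abs, abs_of_pos hρ,
            norm_sub_rev, hρdef]
          exact inv_mul_cancel₀ hab'.ne'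
        calc ‖∑ l ∈ Λ, c l * cexp (l * z)‖
              = ‖(ρ : ℂ)⁻¹ * (b - a) * ∑ l ∈ Λ, c l * cexp (l * z)‖ := by
                rw [norm_mul, h1, one_mul]
          _ = _ := by rw [← hQdiff]
          _ ≤ _ := norm_sub_le _ _
      -- bookkeeping
      have hL : ∀ I : ℝ, I ≤ (∫ s in E, Real.log ‖∑ l ∈ Λ, c l * cexp (l * s)‖) +
          α * (Real.log (270000 / α) + 1) →
          Real.exp (α⁻¹ * I) ≤ Real.exp 1 * (270000 / α) * G := by
        intro I hI
        calc Real.exp (α⁻¹ * I) ≤ Real.exp (α⁻¹ * ((∫ s in E, Real.log ‖∑ l ∈ Λ, c l * cexp (l * s)‖) +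
              α * (Real.log (270000 / α) + 1))) := by gcongr
          _ = Real.exp 1 * (270000 / α) * G := by
              rw [mul_add, ← mul_assoc α⁻¹ α, inv_mul_cancel₀ hEpos.ne', one_mul, Real.exp_add,
                Real.exp_add, Real.exp_log (by positivity), hG]
              ring
      have hQa : ‖∑ l ∈ Λ.erase a, (ρ : ℂ)⁻¹ * ((l - a) * c l) * cexp (l * t)‖ ≤
          Real.exp MRe * (Real.exp 16000 / α) ^ n * (Real.exp 1 * (270000 / α) * G) := by
        calc _ ≤ _ := IHa
          _ ≤ _ := by gcongr; exact hL _ PSa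
      have hQb : ‖∑ l ∈ Λ.erase b, (ρ : ℂ)⁻¹ * ((l - b) * c l) * cexp (l * t)‖ ≤
          Real.exp MRe * (Real.exp 16000 / α) ^ n * (Real.exp 1 * (270000 / α) * G) := by
        calc _ ≤ _ := IHb
          _ ≤ _ := by gcongr; exact hL _ PSb
      have hbig : 2 * (Real.exp 1 * 270000) ≤ Real.exp 16000 := by
        have h1 : Real.exp 1 ≤ 3 := le_of_lt (lt_trans Real.exp_one_lt_d9 (by norm_num))
        have h2 : (8000 : ℝ) + 1 ≤ Real.exp 8000 := Real.add_one_le_exp 8000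
        have h3 : Real.exp 16000 = Real.exp 8000 * Real.exp 8000 := by
          rw [← Real.exp_add]; norm_num
        rw [h3]
        nlinarith [Real.exp_pos 8000]
      have hpos : 0 ≤ Real.exp MRe * (Real.exp 16000 / α) ^ n * G := by positivity
      calc _ ≤ _ := hsplit t
        _ ≤ 2 * (Real.exp MRe * (Real.exp 16000 / α) ^ n * (Real.exp 1 * (270000 / α) * G)) := by
            linarith [hQa, hQb]
        _ = Real.exp MRe * (Real.exp 16000 / α) ^ n * G * ((2 * (Real.exp 1 * 270000)) / α) := by
            ring
        _ ≤ Real.exp MRe * (Real.exp 16000 / α) ^ n * G * (Real.exp 16000 / α) := by gcongr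
        _ = Real.exp MRe * (Real.exp 16000 / α) ^ (n + 1) * G := by ring


/-! ### Part 5e: reduction, scaling, and the Turán–Nazarov inequality -/

/-- Reduction of an exponential sum: merge equal exponents and delete zero coefficients.
[cite: Friedland2026DiskGrowthRemez, Thm 5.1, proof] -/
theorem expsum_reduce {ι : Type*} [Fintype ι] (coef expo : ι → ℂ) :
    ∃ (Λ : Finset ℂ) (C : ℂ → ℂ), Λ.card ≤ Fintype.card ι ∧ (∀ l ∈ Λ, C l ≠ 0) ∧
      (∀ l ∈ Λ, ∃ k, expo k = l) ∧
      ∀ z : ℂ, ∑ k, coef k * cexp (expo k * z) = ∑ l ∈ Λ, C l * cexp (l * z) := by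
  classical
  set C : ℂ → ℂ := fun l => ∑ k ∈ Finset.univ.filter (fun k => expo k = l), coef k with hC
  refine ⟨(Finset.univ.image expo).filter (fun l => C l ≠ 0), C, ?_, ?_, ?_, fun z => ?_⟩
  · exact (Finset.card_filter_le _ _).trans (Finset.card_image_le.trans (by simp))
  · intro l hl
    exact (Finset.mem_filter.1 hl).2
  · intro l hl
    obtain ⟨k, -, hk⟩ := Finset.mem_image.1 (Finset.mem_filter.1 hl).1
    exact ⟨k, hk⟩
  · symm
    rw [Finset.sum_filter_of_ne (by intro l _ h h0; exact h (by rw [h0, zero_mul]))]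
    rw [← Finset.sum_fiberwise_of_maps_to (s := Finset.univ) (t := Finset.univ.image expo)
      (g := expo) (fun k _ => Finset.mem_image_of_mem expo (Finset.mem_univ k))
      (fun k => coef k * cexp (expo k * z))]
    refine Finset.sum_congr rfl fun l _ => ?_
    simp only [hC, Finset.sum_mul]
    refine Finset.sum_congr rfl fun k hk => ?_
    rw [(Finset.mem_filter.1 hk).2]

/-- `G_E(p) ≤ ess sup_E |p|` for a reduced exponential sum: if `|p| ≤ S` on `E` then
`exp(α⁻¹∫_E log|p|) ≤ S` (the zeros of `p` on `E` are a null set).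
[cite: Friedland2026DiskGrowthRemez, Cor 1.3] -/
theorem geom_mean_le_bound (Λ : Finset ℂ) (c : ℂ → ℂ) (hΛ : Λ.Nonempty) (hc : ∀ l ∈ Λ, c l ≠ 0)
    {E : Set ℝ} (hEm : MeasurableSet E) (hE : E ⊆ Icc (-1 / 2 : ℝ) (1 / 2))
    (hEpos : 0 < (volume E).toReal) {S : ℝ} (hS : ∀ s ∈ E, ‖∑ l ∈ Λ, c l * cexp (l * s)‖ ≤ S) :
    Real.exp ((volume E).toReal⁻¹ * ∫ s in E, Real.log ‖∑ l ∈ Λ, c l * cexp (l * s)‖) ≤ S := by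
  have hp0 := expsum_ne_zero hΛ hc
  have hpa : ∀ z, AnalyticAt ℂ (fun z => ∑ l ∈ Λ, c l * cexp (l * z)) z := fun z =>
    expsum_analyticAt Λ c (fun l => l) z
  obtain ⟨s₀, hs₀, hps₀⟩ := exists_mem_ne_zero hpa hp0 hE hEpos
  have hS0 : 0 < S := lt_of_lt_of_le (norm_pos_iff.2 hps₀) (hS s₀ hs₀)
  have hae : ∀ᵐ s : ℝ ∂(volume.restrict E),
      Real.log ‖∑ l ∈ Λ, c l * cexp (l * s)‖ ≤ Real.log S := by
    have h1 := ae_restrict_ne_zero hpa hp0 hEm hE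
    have h2 : ∀ᵐ s : ℝ ∂(volume.restrict E), s ∈ E := ae_restrict_mem hEm
    filter_upwards [h1, h2] with s hs hsE
    exact Real.log_le_log (norm_pos_iff.2 hs) (hS s hsE)
  have hEfin : volume E ≠ ⊤ := by
    intro h; rw [h, ENNReal.toReal_top] at hEpos; exact lt_irrefl _ hEpos
  have hint := integral_mono_ae (log_expsum_integrableOn Λ c hEm hE hEpos)
    (integrableOn_const hEfin) hae
  rw [setIntegral_const, smul_eq_mul, measureReal_def] at hint
  calc Real.exp ((volume E).toReal⁻¹ * ∫ s in E, Real.log ‖∑ l ∈ Λ, c l * cexp (l * s)‖)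
        ≤ Real.exp ((volume E).toReal⁻¹ * ((volume E).toReal * Real.log S)) := by gcongr
    _ = S := by rw [← mul_assoc, inv_mul_cancel₀ hEpos.ne', one_mul, Real.exp_log hS0]

/-- **The Turán–Nazarov inequality** `Literature.Analysis.Approximation.TuranNazarov.lemma` holds,
with the absolute constant `c = e^{16000}`: scale `[a,b]` to `I₀` (Friedland 2026, proof of
Thm 1.2), reduce the exponential sum, apply `geometric_turan_nazarov` (Thm 5.1) and
`G_E(p) ≤ sup_Ω |p|` (Cor 1.3); the exponent `n ≤ m` is raised using `c/α ≥ 1`.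
[cite: Friedland2026DiskGrowthRemez, Thm 1.2 and Cor 1.3] -/
theorem lemma_holds : TuranNazarov.lemma := by
  classical
  refine ⟨Real.exp 16000, Real.exp_pos _, ?_⟩
  intro m coef expo a b hab Ω hΩm hΩ hΩ0 Λr hΛr S hS t ht
  set L : ℝ := b - a with hL
  have hL0 : 0 < L := by rw [hL]; exact sub_pos.2 hab
  set t₀ : ℝ := (a + b) / 2 with ht₀
  obtain ⟨ω, hω⟩ := nonempty_of_measure_ne_zero hΩ0
  have hS0 : 0 ≤ S := (norm_nonneg _).trans (hS ω hω)
  -- the rescaled set `E ⊆ I₀`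
  set E : Set ℝ := {s : ℝ | t₀ + L * s ∈ Ω} with hEdef
  have hEm : MeasurableSet E :=
    hΩm.preimage (by fun_prop : Measurable fun s : ℝ => t₀ + L * s)
  have hEI : E ⊆ Icc (-1 / 2 : ℝ) (1 / 2) := by
    intro s hs
    have h := hΩ hs
    constructor <;> nlinarith [h.1, h.2, hL, ht₀, hL0]
  have hvolE : volume E = ENNReal.ofReal L⁻¹ * volume Ω := by
    have h1 : E = (fun x => L * x) ⁻¹' ((fun y => t₀ + y) ⁻¹' Ω) := rfl
    rw [h1, Real.volume_preimage_mul_left hL0.ne', measure_preimage_add, abs_of_pos (inv_pos.2 hL0)]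
  have hΩfin : volume Ω ≠ ⊤ := by
    refine ne_top_of_le_ne_top ?_ (measure_mono hΩ)
    rw [Real.volume_Icc]; exact ENNReal.ofReal_ne_top
  have hαeq : (volume E).toReal = L⁻¹ * (volume Ω).toReal := by
    rw [hvolE, ENNReal.toReal_mul, ENNReal.toReal_ofReal (inv_pos.2 hL0).le]
  have hΩpos : 0 < (volume Ω).toReal := ENNReal.toReal_pos hΩ0 hΩfin
  have hEpos : 0 < (volume E).toReal := by rw [hαeq]; positivity
  have hα1 : (volume E).toReal ≤ 1 := by
    have h1 : volume E ≤ 1 := (measure_mono hEI).trans (by rw [Real.volume_Icc]; norm_num)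
    have := ENNReal.toReal_mono ENNReal.one_ne_top h1
    rwa [ENNReal.toReal_one] at this
  -- the rescaled exponential sum and its reduction
  set coef' : Fin (m + 1) → ℂ := fun k => coef k * cexp (expo k * t₀) with hcoef'
  set expo' : Fin (m + 1) → ℂ := fun k => expo k * L with hexpo'
  have hresc : ∀ s : ℝ, ∑ k, coef k * cexp (expo k * ((t₀ + L * s : ℝ) : ℂ)) =
      ∑ k, coef' k * cexp (expo' k * s) := by
    intro s
    refine Finset.sum_congr rfl fun k _ => ?_
    simp only [hcoef', hexpo']
    rw [show expo k * ((t₀ + L * s : ℝ) : ℂ) = expo k * (t₀ : ℂ) + expo k * (L : ℂ) * (s : ℂ) by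
      push_cast; ring, Complex.exp_add]
    ring
  obtain ⟨Λ', C, hcard, hC, hspec, hred⟩ := expsum_reduce coef' expo'
  set s : ℝ := (t - t₀) / L with hs
  have hts : t = t₀ + L * s := by rw [hs]; field_simp; ring
  have hsI : s ∈ Icc (-1 / 2 : ℝ) (1 / 2) := by
    rw [hs]
    constructor
    · rw [le_div_iff₀ hL0]; linarith [ht.1]
    · rw [div_le_iff₀ hL0]; linarith [ht.2]
  have hpt : ∑ k, coef k * cexp (expo k * (t : ℂ)) = ∑ l ∈ Λ', C l * cexp (l * (s : ℂ)) := by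
    rw [hts, hresc, hred]
  rw [hpt]
  rcases Λ'.eq_empty_or_nonempty with hΛe | hΛne
  · rw [hΛe, Finset.sum_empty, norm_zero]; positivity
  set n : ℕ := Λ'.card - 1 with hn
  have hcardn : Λ'.card = n + 1 := by have := Finset.card_pos.2 hΛne; omega
  have hnm : n ≤ m := by
    have : Fintype.card (Fin (m + 1)) = m + 1 := Fintype.card_fin _
    omega
  have hMRe : ∀ l ∈ Λ', |l.re| ≤ L * Λr := by
    intro l hl
    obtain ⟨k, rfl⟩ := hspec l hl
    simp only [hexpo', Complex.mul_re, Complex.ofReal_re, Complex.ofReal_im, mul_zero, sub_zero]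
    rw [abs_mul, abs_of_pos hL0, mul_comm]
    exact mul_le_mul_of_nonneg_left (hΛr k) hL0.le
  have main := geometric_turan_nazarov n Λ' C hcardn hC (L * Λr) hMRe E hEm hEI hEpos s hsI
  have hSE : ∀ s ∈ E, ‖∑ l ∈ Λ', C l * cexp (l * s)‖ ≤ S := by
    intro s' hs'
    rw [← hred, ← hresc]
    exact hS _ hs'
  have hG := geom_mean_le_bound Λ' C hΛne hC hEm hEI hEpos hSE
  have hbase : 1 ≤ Real.exp 16000 / (volume E).toReal := by
    rw [le_div_iff₀ hEpos]
    linarith [Real.one_le_exp (by norm_num : (0 : ℝ) ≤ 16000)]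
  have hfrac : Real.exp 16000 / (volume E).toReal = Real.exp 16000 * L / (volume Ω).toReal := by
    rw [hαeq]; field_simp
  calc ‖∑ l ∈ Λ', C l * cexp (l * s)‖ ≤ _ := main
    _ ≤ Real.exp (L * Λr) * (Real.exp 16000 / (volume E).toReal) ^ m * S := by
        apply mul_le_mul (mul_le_mul_of_nonneg_left (pow_le_pow_right₀ hbase hnm)
          (Real.exp_pos _).le) hG (Real.exp_pos _).le
        positivity
    _ = Real.exp (L * Λr) * (Real.exp 16000 * L / (volume Ω).toReal) ^ m * S := by rw [hfrac]


end TuranNazarov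

end Literature.Analysis.Approximation
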